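import Literature.NumberTheory.LFunctions.LandauOscillation
import Literature.NumberTheory.LFunctions.ZetaRealAxis
import HarnessLib

/-!
# Landau's lemma on the real segment, and the real singularity `σ = ½` of `ζ(2s)/(sζ(s))`

Topic `Literature/NumberTheory/LFunctions` (namespace `Literature.NumberTheory.LFunctions`; the two
Landau lemmas extend the sub-namespace `Landau` of `LandauOscillation.lean`). Everything here is
PROVED. These are the two ingredients of the elementary ("Landau") halves of Haselgrove's theorem
that `L(x) = Σ_{n≤x} λ(n)` and `T(x) = Σ_{n≤x} λ(n)/n` change sign infinitely often
(`Literature/Barriers/RiemannHypothesis/LiouvilleSignConjecturesHaselgrove.lean`), kept separate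
because they are about Mellin transforms and about `ζ` on the real axis, not about `λ`:

* `Landau.mellinIoi_eq_of_differentiableOn_union_convex` — the tree's abscissa form of **Landau's
  lemma** (Montgomery–Vaughan §15.1 Lemma 15.1, `Landau.integrableOn_of_differentiableOn_union_convex`:
  an eventually non-negative `g` whose transform `F(s) = ∫_1^∞ g x^{-(s+1)} dx` continues
  holomorphically along the real segment `(a, σ₁+1]` has `∫_1^∞ |g| x^{-(σ+1)} dx < ∞` for all
  `σ > a`) WITH the identification `F(σ) = Φ(σ)` on `a < σ ≤ σ₁ + 1` (identity theorem on the convex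
  set `W₀ ∩ {Re s > a}`), which is the form in which Landau's theorem is quoted in sign-change
  arguments (Mossinghoff–Trudgian 2012, proof of Thm. 2.4: "the domain in which (2.8) is valid may
  be extended …, upon appeal to Landau's theorem, to the first real singularity").
* `Landau.neg_le_integral_of_eventually_nonneg` — the trivial lower bound
  `∫_1^∞ g x^{-(σ+1)} dx ≥ -C X₁ (X₁ - 1)` for `g ≥ 0` beyond `X₁`, `|g(x)| ≤ Cx`, `σ ≥ -1`.
* `zeta_real_segment_bounds`, `zeta_real_pole_lower_bound` — `ζ` is real with `-M ≤ ζ(w) < 0` on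
  `[½, ¾]` (Titchmarsh §2.12, the tree's `riemannZeta_neg_of_pos_of_lt_one`, plus compactness) and
  `ζ(t) ≥ 1/(2(t-1))` on `(1, 1+η)` (the pole, Mathlib's `riemannZeta_residue_one`).
* `exists_zetaRatio_re_lt`, `exists_zetaRatio_re_gt` — hence `ζ(2σ)/(σζ(σ))` takes arbitrarily
  large negative real values as `σ → ½⁺` and `ζ(2w)/((w-1)ζ(w))` arbitrarily large positive ones:
  the real singularity at `½` of the transforms of `L` and of `-T` (Mossinghoff–Trudgian (2.4)–(2.5):
  `f_α(s) = ζ(1+2s)/((s-α+½)ζ(s+½))`, first real singularity at `s = 0`).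
* `isOpen_convex_thinRect` — the thin rectangles `{a < Re s < 4, |Im s| < d}` used as `W₀`.

## References

* [MontgomeryVaughan2007] H. L. Montgomery, R. C. Vaughan, *Multiplicative Number Theory I*, CUP 2007,
  §15.1 Lemma 15.1 (Landau).
* [MossinghoffTrudgian2012] M. J. Mossinghoff, T. S. Trudgian, *Between the problems of Pólya and
  Turán*, J. Aust. Math. Soc. 93 (2012), §2 (2.4)–(2.5), Theorem 2.4 and its proof (2.8)–(2.9) (read).
* [Titchmarsh1986] E. C. Titchmarsh, *The Theory of the Riemann Zeta-Function*, 2nd ed., §2.1 (2.1.4),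
  §2.12.
-/

noncomputable section

open Complex Filter MeasureTheory Set
open scoped Real Topology

namespace Literature.NumberTheory.LFunctions

namespace Landau

/-! ## Landau's lemma: the representation on the real segment, and a lower bound for it -/

/-- At a real point the transform is the real integral `∫_1^∞ g(x) x^{-(σ+1)} dx`. [folklore] -/
theorem mellinIoi_ofReal (g : ℝ → ℝ) (σ : ℝ) :
    mellinIoi g σ = ((∫ x in Ioi (1 : ℝ), g x * x ^ (-(σ + 1)) : ℝ) : ℂ) := by
  rw [← mellinIoiLog_zero, mellinIoiLog_ofReal]
  simp

/-- **Landau's theorem with the continuation identified** (Mossinghoff–Trudgian, proof of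
Thm. 2.4: "Since the integrand has constant sign, the domain in which (2.8) is valid may be
extended … upon appeal to Landau's theorem, to the first real singularity"; Montgomery–Vaughan
Lemma 15.1 as in the tree's `Landau.integrableOn_of_differentiableOn_union_convex`): if `g ≥ 0`
beyond `X₁`, `∫_1^∞ |g| x^{-(σ₁+1)} dx < ∞`, and the transform agrees on `Re s > σ₁` with `Φ`
holomorphic on `{Re s > σ₁} ∪ W₀`, `W₀` convex open containing the real segment `(a, σ₁ + 1]`, then
the integral converges absolutely for every real `σ > a` AND equals `Φ(σ)` for `a < σ ≤ σ₁ + 1`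
(identity theorem on the convex set `W₀ ∩ {Re s > a}`).
[cite: MossinghoffTrudgian2012, proof of Theorem 2.4] [cite: MontgomeryVaughan2007, §15.1 Lemma 15.1] -/
theorem mellinIoi_eq_of_differentiableOn_union_convex {g : ℝ → ℝ} (hg : Measurable g) {σ₁ a X₁ : ℝ}
    (hint : IntegrableOn (fun x ↦ g x * x ^ (-(σ₁ + 1))) (Ioi 1))
    (hX₁ : 1 ≤ X₁) (hpos : ∀ x, X₁ < x → 0 ≤ g x) (ha : a < σ₁)
    {W₀ : Set ℂ} (hW₀o : IsOpen W₀) (hW₀c : Convex ℝ W₀)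
    (hW₀r : ∀ σ : ℝ, a < σ → σ ≤ σ₁ + 1 → (σ : ℂ) ∈ W₀)
    {Φ : ℂ → ℂ} (hΦ : DifferentiableOn ℂ Φ ({s : ℂ | σ₁ < s.re} ∪ W₀))
    (hagree : EqOn Φ (mellinIoi g) {s : ℂ | σ₁ < s.re}) :
    (∀ σ : ℝ, a < σ → IntegrableOn (fun x ↦ g x * x ^ (-(σ + 1))) (Ioi 1)) ∧
    ∀ σ : ℝ, a < σ → σ ≤ σ₁ + 1 → mellinIoi g σ = Φ σ := by
  have hI : ∀ σ : ℝ, a < σ → IntegrableOn (fun x ↦ g x * x ^ (-(σ + 1))) (Ioi 1) := fun σ hσ ↦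
    integrableOn_of_differentiableOn_union_convex hg hint hX₁ hpos ha hW₀o hW₀c hW₀r hΦ
      hagree hσ
  refine ⟨hI, fun σ hσ hσ' ↦ ?_⟩
  have hF : DifferentiableOn ℂ (mellinIoi g) {s : ℂ | a < s.re} :=
    differentiableOn_mellinIoi_of_forall hg hI
  set V : Set ℂ := W₀ ∩ {s : ℂ | a < s.re} with hV
  have hVo : IsOpen V := hW₀o.inter (isOpen_re_gt a)
  have hVc : Convex ℝ V := hW₀c.inter (convex_halfSpace_re_gt a)
  have hΦV : AnalyticOnNhd ℂ Φ V := (hΦ.mono fun s hs ↦ Or.inr hs.1).analyticOnNhd hVo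
  have hFV : AnalyticOnNhd ℂ (mellinIoi g) V :=
    (hF.mono fun s hs ↦ hs.2).analyticOnNhd hVo
  set p : ℂ := ((σ₁ + 1 : ℝ) : ℂ) with hp
  have hp1 : p ∈ {s : ℂ | σ₁ < s.re} := by
    simp only [hp, Set.mem_setOf_eq, Complex.ofReal_re]; linarith
  have hpV : p ∈ V := by
    refine ⟨hW₀r _ (by linarith) le_rfl, ?_⟩
    simp only [hp, Set.mem_setOf_eq, Complex.ofReal_re]; linarith
  have hev : Φ =ᶠ[𝓝 p] mellinIoi g := by
    filter_upwards [(isOpen_re_gt σ₁).mem_nhds hp1] with s hs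
    exact hagree hs
  have hEq : EqOn Φ (mellinIoi g) V :=
    hΦV.eqOn_of_preconnected_of_eventuallyEq hFV hVc.isPreconnected hpV hev
  have hσV : ((σ : ℝ) : ℂ) ∈ V := by
    refine ⟨hW₀r σ hσ hσ', ?_⟩
    simp only [Set.mem_setOf_eq, Complex.ofReal_re]; exact hσ
  exact (hEq hσV).symm

/-- **Lower bound for the transform of an eventually non-negative function.** If `|g(x)| ≤ C x`
on `(1, ∞)`, `g ≥ 0` beyond `X₁ ≥ 1`, and `σ ≥ -1`, then (when the integral converges)
`∫_1^∞ g(x) x^{-(σ+1)} dx ≥ -C X₁ (X₁ - 1)`: the part over `(X₁, ∞)` is `≥ 0` and on `(1, X₁]` the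
integrand is at least `-C X₁` (as `x^{-(σ+1)} ≤ 1`). This is the finiteness "`∫_1^{x₀}`" half of the
Landau contradiction (Mossinghoff–Trudgian (2.9): `|G_α(s)| ≤ C/σ − F_α(σ)`). [cite: MossinghoffTrudgian2012, proof of Theorem 2.4 (2.9)] -/
theorem neg_le_integral_of_eventually_nonneg {g : ℝ → ℝ} {C X₁ σ : ℝ}
    (hX₁ : 1 ≤ X₁) (hC : ∀ x, 1 < x → |g x| ≤ C * x) (hpos : ∀ x, X₁ < x → 0 ≤ g x)
    (hσ : -1 ≤ σ) (hint : IntegrableOn (fun x ↦ g x * x ^ (-(σ + 1))) (Ioi 1)) :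
    -(C * X₁ * (X₁ - 1)) ≤ ∫ x in Ioi (1 : ℝ), g x * x ^ (-(σ + 1)) := by
  have hC0 : 0 ≤ C := by
    have h2 := hC 2 (by norm_num)
    nlinarith [abs_nonneg (g 2)]
  rw [← Ioc_union_Ioi_eq_Ioi hX₁, setIntegral_union (Set.Ioc_disjoint_Ioi le_rfl)
    measurableSet_Ioi (hint.mono_set Ioc_subset_Ioi_self) (hint.mono_set (Ioi_subset_Ioi hX₁))]
  have h1 : -(C * X₁ * (X₁ - 1)) ≤ ∫ x in Ioc 1 X₁, g x * x ^ (-(σ + 1)) := by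
    have hb : ‖∫ x in Ioc 1 X₁, g x * x ^ (-(σ + 1))‖ ≤ C * X₁ * volume.real (Ioc 1 X₁) := by
      refine norm_setIntegral_le_of_norm_le_const (by rw [Real.volume_Ioc]; exact ENNReal.ofReal_lt_top)
        fun x hx ↦ ?_
      have hx1 : 1 < x := hx.1
      have hx0 : 0 < x := by linarith
      rw [Real.norm_eq_abs, abs_mul, abs_of_pos (Real.rpow_pos_of_pos hx0 _)]
      have hp : x ^ (-(σ + 1)) ≤ 1 := Real.rpow_le_one_of_one_le_of_nonpos hx1.le (by linarith)
      calc |g x| * x ^ (-(σ + 1)) ≤ C * x * 1 :=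
            mul_le_mul (hC x hx1) hp (Real.rpow_nonneg hx0.le _) (by positivity)
        _ ≤ C * X₁ := by rw [mul_one]; exact mul_le_mul_of_nonneg_left hx.2 hC0
    rw [Real.volume_real_Ioc_of_le hX₁, Real.norm_eq_abs] at hb
    have := neg_abs_le (∫ x in Ioc 1 X₁, g x * x ^ (-(σ + 1)))
    linarith
  have h2 : 0 ≤ ∫ x in Ioi X₁, g x * x ^ (-(σ + 1)) :=
    setIntegral_nonneg measurableSet_Ioi fun x hx ↦ by
      have hx' : X₁ < x := hx
      exact mul_nonneg (hpos x hx') (Real.rpow_nonneg (by linarith) _)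
  linarith


end Landau

/-! ## `ζ` on the real segments `[½, ¾]` and `(1, 1 + η)` -/

/-- **`ζ` on `[½, ¾]`**: real, negative and bounded (`-M ≤ ζ(w) < 0`), by Titchmarsh §2.12
(`ζ(σ) < 0` on `(0, 1)`, the tree's `riemannZeta_neg_of_pos_of_lt_one`) and continuity on the
compact segment. [cite: Titchmarsh1986, §2.12 (text after (2.12.4))] -/
theorem zeta_real_segment_bounds :
    ∃ M : ℝ, 0 < M ∧ ∀ w : ℝ, 1 / 2 ≤ w → w ≤ 3 / 4 →
      (riemannZeta w).im = 0 ∧ (riemannZeta w).re < 0 ∧ -M ≤ (riemannZeta w).re := by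
  have hcont : ContinuousOn (fun w : ℝ ↦ riemannZeta w) (Icc (1 / 2) (3 / 4)) := by
    intro w hw
    have hw1 : (w : ℂ) ≠ 1 := by
      intro h
      have := congrArg Complex.re h
      simp at this
      linarith [hw.2]
    exact ((differentiableAt_riemannZeta hw1).continuousAt.comp
      Complex.continuous_ofReal.continuousAt).continuousWithinAt
  obtain ⟨C, hC⟩ := (isCompact_Icc (a := (1 / 2 : ℝ)) (b := 3 / 4)).exists_bound_of_continuousOn hcont
  refine ⟨max C 1, by positivity, fun w hw1 hw2 ↦ ?_⟩
  have h0 : 0 < w := by linarith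
  have h1 : w < 1 := by linarith
  refine ⟨riemannZeta_im_eq_zero_of_pos h0 h1.ne, riemannZeta_re_neg_of_pos_of_lt_one h0 h1, ?_⟩
  have hb : ‖riemannZeta w‖ ≤ C := hC w ⟨hw1, hw2⟩
  have := (abs_re_le_norm (riemannZeta w)).trans hb
  have := neg_abs_le (riemannZeta w).re
  linarith [le_max_left C 1]

/-- **The pole of `ζ` at `1` from the right**: there is `η > 0` with `ζ(t)` real and
`ζ(t) ≥ 1/(2(t-1))` for `1 < t < 1 + η` (from `(s-1)ζ(s) → 1`, Mathlib's `riemannZeta_residue_one`).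
[cite: Titchmarsh1986, §2.1 (2.1.4)] -/
theorem zeta_real_pole_lower_bound :
    ∃ η : ℝ, 0 < η ∧ ∀ t : ℝ, 1 < t → t < 1 + η →
      (riemannZeta t).im = 0 ∧ 1 / (2 * (t - 1)) ≤ (riemannZeta t).re := by
  have h := Metric.tendsto_nhds.1 riemannZeta_residue_one (1 / 2) (by norm_num)
  rw [eventually_nhdsWithin_iff, Metric.eventually_nhds_iff] at h
  obtain ⟨η, hη, hball⟩ := h
  refine ⟨η, hη, fun t ht1 ht2 ↦ ?_⟩
  have him : (riemannZeta t).im = 0 := riemannZeta_im_eq_zero_of_one_lt ht1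
  refine ⟨him, ?_⟩
  have hdist : dist (t : ℂ) 1 < η := by
    rw [dist_eq_norm, ← Complex.ofReal_one, ← Complex.ofReal_sub, Complex.norm_real, Real.norm_eq_abs,
      abs_of_pos (by linarith)]
    linarith
  have hne : (t : ℂ) ∈ ({1}ᶜ : Set ℂ) := by
    simp only [Set.mem_compl_iff, Set.mem_singleton_iff]
    intro h
    have := congrArg Complex.re h
    simp at this
    linarith
  have hd := hball hdist hne
  rw [dist_eq_norm] at hd
  -- `Re((t-1)ζ(t)) > 1/2`, and `(t-1)ζ(t)` is real with real part `(t-1) Re ζ(t)`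
  have hre : 1 / 2 < (((t : ℂ) - 1) * riemannZeta t).re := by
    have := (abs_re_le_norm ((((t : ℂ) - 1) * riemannZeta t) - 1)).trans_lt hd
    rw [sub_re, one_re] at this
    have := neg_abs_le ((((t : ℂ) - 1) * riemannZeta t).re - 1)
    linarith [abs_sub_lt_iff.1 ((abs_re_le_norm ((((t : ℂ) - 1) * riemannZeta t) - 1)).trans_lt hd)]
  have hprod : (((t : ℂ) - 1) * riemannZeta t).re = (t - 1) * (riemannZeta t).re := by
    rw [mul_re, him]
    simp
  rw [hprod] at hre
  rw [div_le_iff₀ (by linarith)]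
  nlinarith

/-- For every bound `B` there is a real `σ ∈ (½, ¾]` with `Re (ζ(2σ)/(σ ζ(σ))) < -B`: as `σ → ½⁺`
the numerator `ζ(2σ) → +∞` while `σ ζ(σ)` stays in `[-M, 0)`. This is the "first real singularity"
of the transform of `L` (Mossinghoff–Trudgian: `F_α(σ)`, `σ → 0⁺`, in the variable `s + ½`).
[cite: MossinghoffTrudgian2012, §2 (2.4)–(2.5) and proof of Theorem 2.4] -/
theorem exists_zetaRatio_re_lt (B : ℝ) :
    ∃ σ : ℝ, 1 / 2 < σ ∧ σ ≤ 3 / 4 ∧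
      (riemannZeta (2 * (σ : ℂ)) / ((σ : ℂ) * riemannZeta σ)).re < -B := by
  obtain ⟨M, hM, hseg⟩ := zeta_real_segment_bounds
  obtain ⟨η, hη, hpole⟩ := zeta_real_pole_lower_bound
  -- choose `σ` with `2σ - 1 < min η (1/(2M(|B|+1)))` and `σ ≤ 3/4`
  set ε : ℝ := min (1 / 4) (min (η / 2) (1 / (4 * M * (|B| + 1)))) with hε
  have hε0 : 0 < ε := by positivity
  have hε1 : ε ≤ 1 / 4 := min_le_left _ _
  have hε2 : ε ≤ η / 2 := (min_le_right _ _).trans (min_le_left _ _)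
  have hε3 : ε ≤ 1 / (4 * M * (|B| + 1)) := (min_le_right _ _).trans (min_le_right _ _)
  set σ : ℝ := 1 / 2 + ε / 2 with hσ
  refine ⟨σ, by linarith, by linarith, ?_⟩
  obtain ⟨him, hneg, hlow⟩ := hseg σ (by linarith) (by linarith)
  obtain ⟨him2, hpos2⟩ := hpole (2 * σ) (by linarith) (by linarith)
  -- everything is real
  have h2c : (2 * (σ : ℂ)) = ((2 * σ : ℝ) : ℂ) := by push_cast; ring
  have hz : riemannZeta σ = ((riemannZeta σ).re : ℂ) :=
    Complex.ext (by simp) (by rw [Complex.ofReal_im]; exact him)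
  have hz2 : riemannZeta ((2 * σ : ℝ) : ℂ) = ((riemannZeta ((2 * σ : ℝ) : ℂ)).re : ℂ) :=
    Complex.ext (by simp) (by rw [Complex.ofReal_im]; exact him2)
  rw [h2c, hz, hz2]
  set y : ℝ := (riemannZeta σ).re with hy
  set z : ℝ := (riemannZeta ((2 * σ : ℝ) : ℂ)).re with hzdef
  have hval : (((z : ℝ) : ℂ) / ((σ : ℂ) * (y : ℂ))).re = z / (σ * y) := by
    rw [← Complex.ofReal_mul, ← Complex.ofReal_div, Complex.ofReal_re]
  rw [hval]
  have hσ0 : 0 < σ := by linarith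
  have hz0 : 1 / (2 * (2 * σ - 1)) ≤ z := hpos2
  have h2σ : 2 * σ - 1 = ε := by rw [hσ]; ring
  rw [h2σ] at hz0
  have hzpos : 0 < z := lt_of_lt_of_le (by positivity) hz0
  -- `z/(σ y) ≤ -z/M ≤ -1/(2 ε M) < -B`
  have hσy : σ * y < 0 := mul_neg_of_pos_of_neg hσ0 hneg
  have hσy' : -(M) ≤ σ * y := by nlinarith
  have step1 : z / (σ * y) ≤ -(z / M) := by
    rw [div_le_iff_of_neg hσy]
    have h1 : -(σ * y) / M ≤ 1 := by rw [div_le_one hM]; linarith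
    calc -(z / M) * (σ * y) = z * (-(σ * y) / M) := by ring
      _ ≤ z * 1 := mul_le_mul_of_nonneg_left h1 hzpos.le
      _ = z := mul_one z
  have step2 : 1 / (2 * ε) / M ≤ z / M := div_le_div_of_nonneg_right hz0 hM.le
  have step3 : |B| + 1 ≤ 1 / (2 * ε) / M := by
    rw [div_div, le_div_iff₀ (by positivity)]
    have := mul_le_mul_of_nonneg_right hε3 (show 0 ≤ 4 * M * (|B| + 1) by positivity)
    rw [one_div, inv_mul_cancel₀ (by positivity)] at this
    nlinarith
  have hB : B ≤ |B| := le_abs_self B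
  linarith

/-- The same for the transform of `-T`: for every `B` there is a real `w ∈ (½, ¾]` with
`Re (ζ(2w)/((w-1) ζ(w))) > B`: on `(½, ¾]` the denominator `(w-1)ζ(w)` is positive and at most
`M`, while `ζ(2w) → +∞` as `w → ½⁺`.
[cite: MossinghoffTrudgian2012, §2 (2.4)–(2.5) and proof of Theorem 2.4] -/
theorem exists_zetaRatio_re_gt (B : ℝ) :
    ∃ w : ℝ, 1 / 2 < w ∧ w ≤ 3 / 4 ∧
      B < (riemannZeta (2 * (w : ℂ)) / (((w : ℂ) - 1) * riemannZeta w)).re := by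
  obtain ⟨M, hM, hseg⟩ := zeta_real_segment_bounds
  obtain ⟨η, hη, hpole⟩ := zeta_real_pole_lower_bound
  set ε : ℝ := min (1 / 4) (min (η / 2) (1 / (4 * M * (|B| + 1)))) with hε
  have hε0 : 0 < ε := by positivity
  have hε1 : ε ≤ 1 / 4 := min_le_left _ _
  have hε2 : ε ≤ η / 2 := (min_le_right _ _).trans (min_le_left _ _)
  have hε3 : ε ≤ 1 / (4 * M * (|B| + 1)) := (min_le_right _ _).trans (min_le_right _ _)
  set w : ℝ := 1 / 2 + ε / 2 with hw
  refine ⟨w, by linarith, by linarith, ?_⟩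
  obtain ⟨him, hneg, hlow⟩ := hseg w (by linarith) (by linarith)
  obtain ⟨him2, hpos2⟩ := hpole (2 * w) (by linarith) (by linarith)
  have h2c : (2 * (w : ℂ)) = ((2 * w : ℝ) : ℂ) := by push_cast; ring
  have hz : riemannZeta w = ((riemannZeta w).re : ℂ) :=
    Complex.ext (by simp) (by rw [Complex.ofReal_im]; exact him)
  have hz2 : riemannZeta ((2 * w : ℝ) : ℂ) = ((riemannZeta ((2 * w : ℝ) : ℂ)).re : ℂ) :=
    Complex.ext (by simp) (by rw [Complex.ofReal_im]; exact him2)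
  rw [h2c, hz, hz2]
  set y : ℝ := (riemannZeta w).re with hy
  set z : ℝ := (riemannZeta ((2 * w : ℝ) : ℂ)).re with hzdef
  have hval : (((z : ℝ) : ℂ) / (((w : ℂ) - 1) * (y : ℂ))).re = z / ((w - 1) * y) := by
    rw [← Complex.ofReal_one, ← Complex.ofReal_sub, ← Complex.ofReal_mul, ← Complex.ofReal_div,
      Complex.ofReal_re]
  rw [hval]
  have hz0 : 1 / (2 * (2 * w - 1)) ≤ z := hpos2
  have h2w : 2 * w - 1 = ε := by rw [hw]; ring
  rw [h2w] at hz0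
  have hzpos : 0 < z := lt_of_lt_of_le (by positivity) hz0
  -- `(w-1) y ∈ (0, M/2]`
  have hwy : 0 < (w - 1) * y := mul_pos_of_neg_of_neg (by linarith) hneg
  have hwy' : (w - 1) * y ≤ M := by nlinarith
  have step1 : z / M ≤ z / ((w - 1) * y) := div_le_div_of_nonneg_left hzpos.le hwy hwy'
  have step2 : 1 / (2 * ε) / M ≤ z / M := div_le_div_of_nonneg_right hz0 hM.le
  have step3 : |B| + 1 ≤ 1 / (2 * ε) / M := by
    rw [div_div, le_div_iff₀ (by positivity)]
    have := mul_le_mul_of_nonneg_right hε3 (show 0 ≤ 4 * M * (|B| + 1) by positivity)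
    rw [one_div, inv_mul_cancel₀ (by positivity)] at this
    nlinarith
  have hB : B ≤ |B| := le_abs_self B
  linarith


/-! ## Thin rectangles about real segments -/

/-- The thin rectangle `W₀ = {a < Re s < 4, |Im s| < δ}` is open and convex. [folklore] -/
theorem isOpen_convex_thinRect (a d : ℝ) :
    IsOpen {s : ℂ | a < s.re ∧ s.re < 4 ∧ -d < s.im ∧ s.im < d} ∧
      Convex ℝ {s : ℂ | a < s.re ∧ s.re < 4 ∧ -d < s.im ∧ s.im < d} := by
  have hset : {s : ℂ | a < s.re ∧ s.re < 4 ∧ -d < s.im ∧ s.im < d} =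
      {s : ℂ | a < s.re} ∩ ({s : ℂ | s.re < 4} ∩ ({s : ℂ | -d < s.im} ∩ {s : ℂ | s.im < d})) := by
    ext s; simp
  rw [hset]
  refine ⟨?_, ?_⟩
  · exact (isOpen_lt continuous_const Complex.continuous_re).inter
      ((isOpen_lt Complex.continuous_re continuous_const).inter
      ((isOpen_lt continuous_const Complex.continuous_im).inter
      (isOpen_lt Complex.continuous_im continuous_const)))
  · exact (convex_halfSpace_re_gt _).inter ((convex_halfSpace_re_lt _).inter
      ((convex_halfSpace_im_gt _).inter (convex_halfSpace_im_lt _)))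

end Literature.NumberTheory.LFunctions
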